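import Summits.BirchSwinnertonDyer.BirchSwinnertonDyer.Theorems.KatoDescentPotSupersingularFineSelmerLeSignedSelmer
import HarnessLib

/-!
# The FINE CONTROL road, tools I: local nilpotence of `conj_γ − 1` on `H¹(K_∞, E[p^∞])`, monogenic
# decomposition groups modulo a layer, and the `p`-group lemma for fixed vectors of `E[p^∞]` (route
# `KatoDescentPotSupersingular`, rung K9, cell `bsd-potss`; a `--supports … --as helper` file; seat
# `bsd-potss-k9-c4` g6; ROUTE-FREE; nothing booked, BSD is not proved by any of this)

WHY. The sibling `…FineSelmerControl.lean` proves Greenberg's Prop. 3.8 for the FINE Selmer group,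
REDUCTION-TYPE-FREE at every place: `#Sel_{p^∞}(E/K) = 1` and no `K_v`-rational `p`-torsion at the bad
places and at `v ∣ p` ⟹ `Sel₀(K_∞, E[p^∞]) = 0` ⟹ Coates–Sujatha's (A) at `(E, p)` — the kernel link that
makes congruent anchors with ADDITIVE reduction at `3` usable for the Conj-A crux `WildFineSelmerCoatesSujatha`
(item stmt-BirchSwinnertonDyer-19386; the census of seat `conjA-anchor` g0 left 149 rows whose only congruent
partners are additive at `3`). THIS FILE holds the three generic tools (EVERY field `K` where not said
otherwise, prime `p`, model `W/K`, `ℤ_p`-extension `κ`):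

* §1 `eq_bot_of_forall_conjH1_eq` — a `conj_γ`-stable subgroup of `H¹(K_∞, E[p^∞])` with no non-zero
  `γ`-fixed class is trivial (`conj_γ − 1` is locally nilpotent: tree lemma
  `IwasawaDual.pow_mul_prime_pow_apply_eq_zero` with `exists_conjH1_pow_prime_pow_eq`) — the Selmer-side
  form of Greenberg's "`X/TX = 0 ⟹ X = 0`"; `fineSelmerInfty_eq_bot_of_forall_conjH1_eq`.
* §2 `exists_generator_mod_layerSubgroup` — a subgroup `D ≤ Γ_K` is generated by ONE of its elements
  modulo `Gal(K̄/K_m) = κ⁻¹(p^m ℤ_p)` (`Γ_K ⧸ κ⁻¹(p^m ℤ_p)` is cyclic, generated by a topological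
  generator; subgroups of cyclic groups are cyclic).
* §3 `eq_zero_of_forall_layer_inf_smul_eq` — if no non-zero `p`-TORSION element of `E[p^∞]` is fixed by
  `D`, then no non-zero element of `E[p^∞]` is fixed by `Gal(K̄/K_m) ⊓ D`, for every `m` (the `p`-group
  lemma "`E(K_v)[p] = 0 ⟹ E(K_v·K_m)[p^∞] = 0`", via §2 and the same local nilpotence).

HONEST FRAMING: unconditional kernel plumbing; no named fact, no definition, no item closed (19386/19197
stay open; class-wide = Coates–Sujatha (A), a named open problem); no census number is an input.
References: R. Greenberg, LNM 1716 (1999) Prop. 3.8 (pp. 95–96), §3 p. 94 fact (1), p. 87 (proof of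
Lemma 3.3) [GreenbergLNM1716]; J.-P. Serre, *Galois Cohomology* I.§2.5–2.6 [SerreGaloisCohomology1997];
L. Washington, GTM 83, §13.1 [Washington1997].
-/

set_option autoImplicit false
-- sibling precedent (`KatoDescentPotSupersingularAssembly.lean`): the directory name repeats the summit name
set_option linter.dupNamespace false

noncomputable section

open scoped Classical

universe u

namespace Summit.BirchSwinnertonDyer.BirchSwinnertonDyer.Theorems.FineSelmerControl

open NumberField IsDedekindDomain Field
open Literature.NumberTheory.EllipticCurves Literature.NumberTheory.EllipticCurves.GreenbergSelmer
  Literature.NumberTheory.EllipticCurves.ZpExtension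
  Literature.NumberTheory.GaloisRepresentations
  Summit.BirchSwinnertonDyer.BirchSwinnertonDyer.Theorems
  Summit.BirchSwinnertonDyer.BirchSwinnertonDyer.Theorems.FineSelmerLeSignedSelmer

/-! ## §0 Two elementary lemmas on additive groups -/

section Algebra

variable {X : Type*} [AddCommGroup X]

/-- If an endomorphism `g` of an additive group preserves a subgroup `A`, kills no non-zero element of
`A`, and is nilpotent on every element of `A`, then `A = 0` (induction on the nilpotence exponent).
[folklore] -/
theorem addSubgroup_eq_bot_of_locallyNilpotent (g : AddMonoid.End X) (A : AddSubgroup X)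
    (hA : ∀ x ∈ A, g x ∈ A) (hker : ∀ x ∈ A, g x = 0 → x = 0)
    (hnil : ∀ x ∈ A, ∃ N : ℕ, (g ^ N) x = 0) : A = ⊥ := by
  refine (AddSubgroup.eq_bot_iff_forall _).2 fun x hx ↦ ?_
  obtain ⟨N, hN⟩ := hnil x hx
  induction N generalizing x with
  | zero => rwa [pow_zero, AddMonoid.End.one_apply] at hN
  | succ N ih =>
    rw [pow_succ, AddMonoid.End.coe_mul, Function.comp_apply] at hN
    exact hker x hx (ih (g x) (hA x hx) hN)

/-- In a `p`-primary additive group, a subgroup without non-zero `p`-torsion is trivial. [folklore] -/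
theorem addSubgroup_eq_bot_of_forall_smul_eq_zero {p : ℕ} (A : AddSubgroup X)
    (hprim : ∀ x ∈ A, ∃ k : ℕ, p ^ k • x = 0) (hp : ∀ x ∈ A, p • x = 0 → x = 0) : A = ⊥ := by
  refine (AddSubgroup.eq_bot_iff_forall _).2 fun x hx ↦ ?_
  obtain ⟨k, hk⟩ := hprim x hx
  induction k generalizing x with
  | zero => rwa [pow_zero, one_smul] at hk
  | succ k ih =>
    rw [pow_succ, mul_smul] at hk
    exact hp x hx (ih (p • x) (A.nsmul_mem hx p) hk)

end Algebra

/-! ## §1 A `conj_γ`-stable subgroup of `H¹(K_∞, E[p^∞])` without non-zero `γ`-fixed classes is trivial -/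

section Global

variable {K : Type u} [Field K] [NumberField K] (W : WeierstrassCurve K) {p : ℕ} [Fact p.Prime]
  (κ : ZpExtension K p)

omit [NumberField K] [Fact p.Prime] in
/-- `(conj_σ)^m = conj_{σ^m}` on `H¹(H, E[p^∞])` (`conjH1_one`, `conjH1_mul`), for `conj_σ` viewed as an
element `φ` of the endomorphism ring. [cite: SerreGaloisCohomology1997, I.§2.5] -/
theorem conjH1_pow (H : Subgroup (absoluteGaloisGroup K)) [H.Normal] (σ : absoluteGaloisGroup K)
    (φ : AddMonoid.End (W.subgroupH1 p H)) (hφ : φ = W.conjH1 p H σ) (m : ℕ) :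
    φ ^ m = W.conjH1 p H (σ ^ m) := by
  subst hφ
  induction m with
  | zero => rw [pow_zero, pow_zero]; exact (W.conjH1_one_holds p H).symm
  | succ m ih => rw [pow_succ, pow_succ, W.conjH1_mul_holds p H, ih]; rfl

/-- **A `conj_γ`-stable subgroup `A ⊆ H¹(K_∞, E[p^∞])` in which `conj_γ` fixes no non-zero class is
trivial** (`γ` a topological generator of the `ℤ_p`-extension `κ`). Every class `c` is `p`-power torsion
(`exists_pow_smul_subgroupH1_ker_eq_zero`) and fixed by `conj_{γ^{p^a}}` for some `a`
(`exists_conjH1_pow_prime_pow_eq`), so `(conj_γ − 1)^{k p^a} c = 0`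
(`IwasawaDual.pow_mul_prime_pow_apply_eq_zero`); the last non-zero iterate would be a non-zero
`γ`-fixed class in `A`. This is the step "`X/TX = 0 ⟹ X = 0`" of Greenberg's Prop. 3.8 on the Selmer side
(no Pontryagin dual needed). [cite: GreenbergLNM1716, §3 p. 94 fact (1) and p. 96 (proof of Prop. 3.8)] -/
theorem eq_bot_of_forall_conjH1_eq {γ : absoluteGaloisGroup K} (hγ : κ.IsTopGenerator γ)
    (A : AddSubgroup (W.subgroupH1 p κ.kerSubgroup))
    (hA : ∀ c ∈ A, W.conjH1 p κ.kerSubgroup γ c ∈ A)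
    (hfix : ∀ c ∈ A, W.conjH1 p κ.kerSubgroup γ c = c → c = 0) : A = ⊥ := by
  obtain ⟨φ, hφ⟩ : ∃ φ : AddMonoid.End (W.subgroupH1 p κ.kerSubgroup), φ = W.conjH1 p κ.kerSubgroup γ :=
    ⟨_, rfl⟩
  have hg_apply : ∀ c, (φ - 1) c = W.conjH1 p κ.kerSubgroup γ c - c := fun c ↦ by
    rw [IwasawaDual.End_sub_apply, AddMonoid.End.one_apply, hφ]; rfl
  refine addSubgroup_eq_bot_of_locallyNilpotent (φ - 1) A (fun c hc ↦ ?_) (fun c hc h0 ↦ ?_)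
    (fun c _ ↦ ?_)
  · rw [hg_apply]; exact A.sub_mem (hA c hc) hc
  · rw [hg_apply, sub_eq_zero] at h0; exact hfix c hc h0
  · obtain ⟨a, ha⟩ := W.exists_conjH1_pow_prime_pow_eq κ hγ c
    obtain ⟨k, hk⟩ := W.exists_pow_smul_subgroupH1_ker_eq_zero κ c
    have ha' : (φ ^ p ^ a) c = c := by rw [conjH1_pow W κ.kerSubgroup γ φ hφ]; exact ha
    exact ⟨k * p ^ a, IwasawaDual.pow_mul_prime_pow_apply_eq_zero (Fact.out : p.Prime) _ a ha' hk⟩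

/-- **`Sel₀(K_∞, E[p^∞]) = 0` as soon as `conj_γ` fixes no non-zero fine Selmer class** (the fine Selmer
group is `conj`-stable, `conjH1_mem_fineSelmerInfty`). [cite: GreenbergLNM1716, §3 p. 96 (proof of Prop. 3.8)]
[cite: CoatesSujatha2005, §3] -/
theorem fineSelmerInfty_eq_bot_of_forall_conjH1_eq {γ : absoluteGaloisGroup K} (hγ : κ.IsTopGenerator γ)
    (hfix : ∀ c ∈ W.fineSelmerInfty κ, W.conjH1 p κ.kerSubgroup γ c = c → c = 0) :
    W.fineSelmerInfty κ = ⊥ :=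
  eq_bot_of_forall_conjH1_eq W κ hγ _ (fun _ hc ↦ W.conjH1_mem_fineSelmerInfty κ γ hc) hfix

end Global

/-! ## §2 A subgroup of `Γ_K` is monogenic modulo `Gal(K̄/K_m)` -/

section Generator

variable {K : Type u} [Field K] {p : ℕ} [Fact p.Prime] (κ : ZpExtension K p)

/-- **`Γ_K ⧸ Gal(K̄/K_m)` is cyclic**, generated by the image of a topological generator `γ`
(`σ ≡ γ^i` for some `i < p^m`, `exists_lt_pow_inv_mul_mem_layerSubgroup`). [cite: Washington1997, §13.1] -/
theorem isCyclic_quotient_layerSubgroup {γ : absoluteGaloisGroup K} (hγ : κ.IsTopGenerator γ) (m : ℕ) :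
    IsCyclic (absoluteGaloisGroup K ⧸ κ.layerSubgroup m) := by
  refine ⟨⟨QuotientGroup.mk γ, fun q ↦ ?_⟩⟩
  obtain ⟨σ, rfl⟩ := QuotientGroup.mk_surjective q
  obtain ⟨i, -, hi⟩ := exists_lt_pow_inv_mul_mem_layerSubgroup κ hγ m σ
  refine ⟨i, ?_⟩
  show (QuotientGroup.mk γ : absoluteGaloisGroup K ⧸ κ.layerSubgroup m) ^ (i : ℤ) = QuotientGroup.mk σ
  rw [zpow_natCast, ← QuotientGroup.mk_pow]
  exact QuotientGroup.eq.2 hi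

/-- **Every subgroup `D ≤ Γ_K` is generated by ONE of its elements modulo `Gal(K̄/K_m) = κ⁻¹(p^m ℤ_p)`**:
there is `d₀ ∈ D` such that every `d ∈ D` is `d₀^z · τ` with `τ ∈ Gal(K̄/K_m)` (the image of `D` in the
finite cyclic group `Γ_K ⧸ Gal(K̄/K_m) ≅ ℤ/p^m` is cyclic). For `D = D_v` a decomposition group this is the
local statement "`Gal(K_{∞,w}/K_v)` is procyclic" read modulo `p^m`. [cite: Washington1997, §13.1]
[cite: GreenbergLNM1716, §3 p. 87 (proof of Lemma 3.3)] -/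
theorem exists_generator_mod_layerSubgroup (D : Subgroup (absoluteGaloisGroup K)) (m : ℕ) :
    ∃ d₀ ∈ D, ∀ d ∈ D, ∃ z : ℤ, (d₀ ^ z)⁻¹ * d ∈ κ.layerSubgroup m := by
  obtain ⟨γ, hγ⟩ := κ.surjective (Multiplicative.ofAdd 1)
  haveI := isCyclic_quotient_layerSubgroup κ (hγ : κ.IsTopGenerator γ) m
  set π : absoluteGaloisGroup K →* absoluteGaloisGroup K ⧸ κ.layerSubgroup m :=
    QuotientGroup.mk' (κ.layerSubgroup m) with hπ
  obtain ⟨g, hg⟩ := (Subgroup.isCyclic_iff_exists_zpowers_eq_top (D.map π)).1 inferInstance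
  have hgmem : g ∈ D.map π := by rw [← hg]; exact Subgroup.mem_zpowers g
  obtain ⟨d₀, hd₀, hd₀g⟩ := Subgroup.mem_map.1 hgmem
  refine ⟨d₀, hd₀, fun d hd ↦ ?_⟩
  have hdmem : π d ∈ Subgroup.zpowers g := by rw [hg]; exact Subgroup.mem_map_of_mem π hd
  obtain ⟨z, hz⟩ := Subgroup.mem_zpowers_iff.1 hdmem
  refine ⟨z, QuotientGroup.eq.1 ?_⟩
  change π (d₀ ^ z) = π d
  rw [map_zpow, hd₀g, hz]

end Generator

/-! ## §3 The `p`-group lemma: no `D`-fixed `p`-torsion ⟹ no `Gal(K̄/K_m) ⊓ D`-fixed vector -/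

section FixedPoints

variable {K : Type u} [Field K] (W : WeierstrassCurve K) {p : ℕ} [Fact p.Prime] (κ : ZpExtension K p)

/-- `g • x = x` implies `g^z • x = x` for every integer `z`. [folklore] -/
theorem zpow_smul_eq_self_of_smul_eq_self {G : Type*} [Group G] {α : Type*} [MulAction G α] {g : G}
    {x : α} (h : g • x = x) (z : ℤ) : g ^ z • x = x := by
  have hn : ∀ n : ℕ, g ^ n • x = x := fun n ↦ by
    induction n with
    | zero => rw [pow_zero, one_smul]
    | succ n ih => rw [pow_succ, mul_smul, h, ih]
  cases z with
  | ofNat n => rw [Int.ofNat_eq_natCast, zpow_natCast, hn]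
  | negSucc n => rw [zpow_negSucc, inv_smul_eq_iff, hn]

/-- **The `p`-group lemma at a subgroup `D ≤ Γ_K`.** If no non-zero `p`-torsion element of `E[p^∞]` is
fixed by `D`, then for every `m` no non-zero element of `E[p^∞]` is fixed by `Gal(K̄/K_m) ⊓ D`. Proof: the
fixed module `A = E[p^∞]^{Gal(K̄/K_m) ⊓ D}` is `D`-stable (normality of `Gal(K̄/K_m)`) and `p`-primary;
with `d₀` generating `D` modulo `Gal(K̄/K_m)` (§2), `d₀^{p^m}` acts trivially on `A`, so `d₀ − 1` is
locally nilpotent on `A` (`IwasawaDual.pow_mul_prime_pow_apply_eq_zero`); a non-zero `A` would contain a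
non-zero `d₀`-fixed, hence `D`-fixed, element, hence (multiplying by a power of `p`) a `D`-fixed
`p`-torsion one. For `D = D_v`: "`E(K_v)[p] = 0 ⟹ E(K_v · K_m)[p^∞] = 0`", the pro-`p` step behind
`ker r_v = 0` in Greenberg's Prop. 3.8 (iii). [cite: GreenbergLNM1716, §3 pp. 95–96 (Prop. 3.8 (iii) and its proof)] -/
theorem eq_zero_of_forall_layer_inf_smul_eq (D : Subgroup (absoluteGaloisGroup K)) (m : ℕ)
    (hloc : ∀ x : W.geomPrimaryTorsion p, p • x = 0 → (∀ d ∈ D, d • x = x) → x = 0)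
    (x : W.geomPrimaryTorsion p) (hx : ∀ τ ∈ κ.layerSubgroup m ⊓ D, τ • x = x) : x = 0 := by
  -- the fixed module `A` of `N = Gal(K̄/K_m) ⊓ D`
  set N : Subgroup (absoluteGaloisGroup K) := κ.layerSubgroup m ⊓ D with hN
  let A : AddSubgroup (W.geomPrimaryTorsion p) :=
    { carrier := {y | ∀ τ ∈ N, τ • y = y}
      add_mem' := fun {a b} ha hb τ hτ ↦ by rw [smul_add, ha τ hτ, hb τ hτ]
      zero_mem' := fun τ _ ↦ smul_zero τ
      neg_mem' := fun {a} ha τ hτ ↦ by rw [smul_neg, ha τ hτ] }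
  have hA_mem : ∀ y, y ∈ A ↔ ∀ τ ∈ N, τ • y = y := fun y ↦ Iff.rfl
  -- `D`-fixed elements of `E[p^∞]` vanish (not only the `p`-torsion ones)
  have hD : ∀ y : W.geomPrimaryTorsion p, (∀ d ∈ D, d • y = y) → y = 0 := by
    let B : AddSubgroup (W.geomPrimaryTorsion p) :=
      { carrier := {y | ∀ d ∈ D, d • y = y}
        add_mem' := fun {a b} ha hb d hd ↦ by rw [smul_add, ha d hd, hb d hd]
        zero_mem' := fun d _ ↦ smul_zero d
        neg_mem' := fun {a} ha d hd ↦ by rw [smul_neg, ha d hd] }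
    have hB : B = ⊥ := addSubgroup_eq_bot_of_forall_smul_eq_zero (p := p) B
      (fun y _ ↦ exists_pow_smul_geomPrimaryTorsion_eq_zero W y)
      (fun y hy hpy ↦ hloc y hpy hy)
    intro y hy
    have hyB : y ∈ B := hy
    rw [hB, AddSubgroup.mem_bot] at hyB
    exact hyB
  -- a generator `d₀` of `D` modulo `Gal(K̄/K_m)`; its action `φ` on `E[p^∞]`
  obtain ⟨d₀, hd₀, hgen⟩ := exists_generator_mod_layerSubgroup κ D m
  set φ : AddMonoid.End (W.geomPrimaryTorsion p) := DistribSMul.toAddMonoidHom _ d₀ with hφ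
  have hφ_apply : ∀ y, φ y = d₀ • y := fun y ↦ rfl
  have hsub_apply : ∀ y, (φ - 1) y = d₀ • y - y := fun y ↦ by
    rw [IwasawaDual.End_sub_apply, AddMonoid.End.one_apply, hφ_apply]
  -- conjugation by `d₀` preserves `N`
  have hconj : ∀ τ ∈ N, d₀⁻¹ * τ * d₀ ∈ N := fun τ hτ ↦ by
    obtain ⟨hτm, hτD⟩ := Subgroup.mem_inf.1 hτ
    refine Subgroup.mem_inf.2 ⟨?_, D.mul_mem (D.mul_mem (D.inv_mem hd₀) hτD) hd₀⟩
    have h := (κ.layerSubgroup_normal m).conj_mem τ hτm d₀⁻¹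
    rwa [inv_inv] at h
  -- `A` is `φ`-stable
  have hAφ : ∀ y ∈ A, (φ - 1) y ∈ A := fun y hy ↦ by
    rw [hsub_apply]
    refine A.sub_mem (fun τ hτ ↦ ?_) hy
    rw [smul_smul, show τ * d₀ = d₀ * (d₀⁻¹ * τ * d₀) by group, mul_smul,
      (hA_mem y).1 hy _ (hconj τ hτ)]
  -- `A = 0` by local nilpotence of `φ - 1`
  have hAbot : A = ⊥ := by
    refine addSubgroup_eq_bot_of_locallyNilpotent (φ - 1) A hAφ (fun y hy h0 ↦ ?_) (fun y hy ↦ ?_)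
    · -- a `d₀`-fixed element of `A` is `D`-fixed
      rw [hsub_apply, sub_eq_zero] at h0
      refine hD y fun d hd ↦ ?_
      obtain ⟨z, hz⟩ := hgen d hd
      have hτ : (d₀ ^ z)⁻¹ * d ∈ N :=
        Subgroup.mem_inf.2 ⟨hz, D.mul_mem (D.inv_mem (D.zpow_mem hd₀ z)) hd⟩
      calc d • y = (d₀ ^ z * ((d₀ ^ z)⁻¹ * d)) • y := by rw [mul_inv_cancel_left]
        _ = d₀ ^ z • (((d₀ ^ z)⁻¹ * d) • y) := mul_smul _ _ _
        _ = y := by rw [(hA_mem y).1 hy _ hτ, zpow_smul_eq_self_of_smul_eq_self h0]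
    · -- `φ^{p^m} y = d₀^{p^m} • y = y` (`d₀^{p^m} ∈ N`) and `y` is `p`-power torsion
      obtain ⟨k, hk⟩ := exists_pow_smul_geomPrimaryTorsion_eq_zero W y
      have hpow : ∀ n : ℕ, (φ ^ n) y = d₀ ^ n • y := fun n ↦ by
        induction n with
        | zero => rw [pow_zero, pow_zero, one_smul, AddMonoid.End.one_apply]
        | succ n ih => rw [pow_succ', AddMonoid.End.coe_mul, Function.comp_apply, ih, hφ_apply,
            smul_smul, pow_succ']
      have hmem : d₀ ^ p ^ m ∈ N := by
        refine Subgroup.mem_inf.2 ⟨?_, D.pow_mem hd₀ _⟩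
        rw [ZpExtension.mem_layerSubgroup, map_pow, toAdd_pow, nsmul_eq_mul, Nat.cast_pow]
        exact Dvd.intro _ rfl
      have hfix : (φ ^ p ^ m) y = y := by rw [hpow, (hA_mem y).1 hy _ hmem]
      exact ⟨k * p ^ m, IwasawaDual.pow_mul_prime_pow_apply_eq_zero (Fact.out : p.Prime) φ m hfix hk⟩
  have hxA : x ∈ A := hx
  rw [hAbot, AddSubgroup.mem_bot] at hxA
  exact hxA

end FixedPoints

end Summit.BirchSwinnertonDyer.BirchSwinnertonDyer.Theorems.FineSelmerControl

end
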